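import Literature.Geometry.Riemannian.PerelmanEntropyFormulaManifold
import Literature.Geometry.Riemannian.FamilyLaplacianRegularity
import Literature.Geometry.Riemannian.MetricFlowPhiInv
import HarnessLib

/-!
# Bamler's improved gradient estimate for the heat equation on a Ricci flow background
# (Bamler 2020a, Thm. 4.1)

R. Bamler, *Entropy and heat kernel bounds on a Ricci flow background*, arXiv:2008.07093 (2020a),
§4.1, **Theorem 4.1**: "Consider a solution `u ∈ C^∞(M × [t₀, t₁])`, `[t₀, t₁] ⊂ I`, to the heat
equation `∂ₜu = Δ_{g_t} u` coupled with the super Ricci flow `(M, (g_t)_{t ∈ I})` [on a compact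
manifold] and let `T ≥ 0`. Suppose that `u` only takes values in `(0, 1)` and suppose that
`|∇(Φ_T⁻¹(u(·, t₀)))| ≤ 1` if `T > 0`. Then `|∇(Φ⁻¹_{T+t−t₀}(u(·, t)))| ≤ 1` for all
`t ∈ [t₀, t₁]`." Here `Φ` is the antiderivative `Φ'(x) = (4π)^{-1/2} e^{-x²/4}` with `Φ(−∞) = 0`,
`Φ(∞) = 1` (the tree's `MetricFlow.Phi`, with inverse `MetricFlow.PhiInv` on `(0, 1)`,
`MetricFlowPhi.lean` / `MetricFlowPhiInv.lean`) and `Φ_τ(x) = Φ(τ^{-1/2} x)`, so that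
`Φ_τ⁻¹ = τ^{1/2} Φ⁻¹` and the statement reads `(T + t − t₀) |∇(Φ⁻¹ ∘ u_t)|²_{g_t} ≤ 1` given
`T |∇(Φ⁻¹ ∘ u_{t₀})|² ≤ 1`. This is the sharp gradient bound behind item (6) of the definition of a
metric flow (Bamler 2023, Def. 3.2) for the metric flow of a smooth Ricci flow, and behind the
heat-kernel gradient bounds of 2020a, Prop. 4.2.

This file PROVES Theorem 4.1 for a Ricci flow `(g, cov)` of Riemannian metrics (`IsRicciFlow`,
`RicciFlow.lean`) on a closed manifold with boundaryless finite-dimensional model, on the time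
interval `[0, T']` (`IsRicciFlow.bamler_gradientEstimate`), following Bamler's proof (§4.2) at the
fixed scale `1` in the variable `v = Φ⁻¹ ∘ u`:

* Part A (coordinates, `MetricCoord.IsMetricFamilyOn.tDerivFun_gradSqAt_eq_of_halfFlow`,
  `…_le_of_halfFlow`): for a coordinate Ricci flow `∂G/∂t = −2Ric(G)` and `v` solving
  `∂ₜv = Δv − ½ v|∇v|²`, the function `w = |∇v|²` satisfies
  `∂ₜw = Δw − 2|Hess v|² − w² − v⟨∇v, ∇w⟩ ≤ Δw − w² − v⟨∇v, ∇w⟩` — the flow's `2Ric(∇v,∇v)`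
  (`hasDerivWithinAt_gradSqAt_ricciFlow`, `CoordEntropyEvolution.lean`) cancels against the
  Bochner formula (`IsMetricOn.lapAt_gradSqAt`, `CoordBochner.lean`);
* Part C (coordinates, `MetricCoord.tDerivFun_PhiInv_eq_of_heat`): if `u ∈ (0,1)` solves
  `∂ₜu = Δu` then `v = Φ⁻¹ ∘ u` solves `∂ₜv = Δv − ½ v|∇v|²` (chain rules and `Φ'' = −(x/2)Φ'`,
  `MetricFlow.deriv_deriv_Phi`);
* Part B (manifold, `IsRicciFlow.derivWithin_gradSq_PhiInv_le`): the differential inequality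
  `∂ₜw ≤ Δ_{g(t)}w − v g⁻¹(dw, dv) − w²` on `M × [0, T']`, transported through the chart at a
  point exactly as Topping's Prop. 8.2.6 in `PerelmanEntropyFormulaManifold.lean` (bridges
  `lapAt_chartRep_eq`, `gradSqAt_chartRep_eq`, and `innerDual_chartRep_eq` proved here);
* Part D (manifold, closed `M`): the weak maximum principle (`weakMaximumPrinciple`, Topping 2006
  Thm. 3.1.1, `RicciFlowScalarMaximumPrinciple.lean`) with drift `X = −v∇v` and reaction
  `F(r) = −r²` gives `w_t ≤ α/(1 + αt)` for any bound `α ≥ 0` of `w₀`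
  (`IsRicciFlow.gradSq_PhiInv_le_div`), whence Theorem 4.1 (`α = 1/T` for `T > 0`; for `T = 0`
  any bound, by compactness, as in Bamler's reduction "we may prove the theorem for small `T` and
  then let `T ↘ 0`").

Everything is proved; no definitions, no named facts. What is NOT here: super Ricci flows
(`∂ₜg ≥ −2Ric`, for which Bamler states the theorem; the tree's flow layer is the Ricci flow
equation), Prop. 4.2 (the integral bounds for `|∇ₓK|/K`, which needs the heat kernel `K`), and the
passage to merely Lipschitz / measurable initial data of Bamler 2023, §3.7.

## References

* R. H. Bamler, *Entropy and heat kernel bounds on a Ricci flow background*, arXiv:2008.07093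
  (2020), §4.1, Thm. 4.1; §4.2 (its proof). [Bamler2020Entropy]
* R. H. Bamler, *Compactness theory of the space of super Ricci flows*, Invent. Math. 233 (2023),
  1121–1277, §3, (3.1) and Def. 3.2 (6). [Bamler2023]
* P. Topping, *Lectures on the Ricci flow*, LMS Lecture Note Series 325, CUP 2006, Thm. 3.1.1
  (weak maximum principle), proof of Prop. 8.2.6 (Bochner formula under the flow). [Topping2006]
* B. O'Neill, *Semi-Riemannian geometry with applications to relativity*, Academic Press 1983,
  Ch. 3, Prop. 3.59 and p. 60 (local isometries; `♯`). [ONeill1983]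
-/

noncomputable section

set_option maxSynthPendingDepth 3

open Set Filter Function Module
open scoped Topology ContDiff Manifold

/-! ## Part A — the evolution of `|∇v|²` for `∂ₜv = Δv − (v/2)|∇v|²` in coordinates -/

namespace Literature.Geometry.Lorentzian

namespace MetricCoord

namespace IsMetricFamilyOn

variable {E : Type*} [NormedAddCommGroup E] [NormedSpace ℝ E] [FiniteDimensional ℝ E]
  [CompleteSpace E] {G : ℝ → E → E →L[ℝ] E →L[ℝ] ℝ} {S : Set ℝ} {V : Set E} {x : E} {t : ℝ}
  {v : ℝ → E → ℝ}

variable (hG : IsMetricFamilyOn G S V)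
  (hfl : ∀ s ∈ S, ∀ y ∈ V, tDeriv G S s y = (-2 : ℝ) • ricAt (G s) y)
include hG hfl

/-- **The evolution of `|∇h|²` in Bamler's proof of the gradient estimate, in coordinates**
(Bamler 2020a, proof of Thm. 4.1, the two displays after "Therefore, by Bochner's identity", at
scale `t = 1`). Let `G` be a smooth one-parameter family of metric components on `V × S` solving
the Ricci flow in coordinates `∂G/∂t = −2 Ric(G)` and `v` a time-dependent function, `C^∞` on
`V × S`, solving at time `t` on `V` the equation `∂ₜv = Δv − ½ v |∇v|²` (the equation of
`v = Φ⁻¹ ∘ u` for a heat solution `u`, `Φ'' = −(x/2)Φ'`). Then at `x ∈ V`, with `w = |∇v|²_G`: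

  `∂ₜ w = Δ w − 2|Hess v|² − w² − v · Dw(♯Dv)`

(`∂ₜ|∇v|² = 2Ric(∇v,∇v) + 2⟨∇v̇, ∇v⟩` under the flow, `hasDerivWithinAt_gradSqAt_ricciFlow`; the
Bochner formula `Δ|∇v|² = 2|Hess v|² + 2⟨∇v, ∇Δv⟩ + 2Ric(∇v,∇v)`, `lapAt_gradSqAt`; and
`⟨∇v, ∇(−½ v w)⟩ = −½ w² − ½ v ⟨∇v, ∇w⟩`). [cite: Bamler2020Entropy, §4.2, proof of Thm. 4.1] -/
theorem tDerivFun_gradSqAt_eq_of_halfFlow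
    (hv : ContDiffOn ℝ ∞ (fun p : E × ℝ ↦ v p.2 p.1) (V ×ˢ S)) (hx : x ∈ V) (ht : t ∈ S)
    (hveq : ∀ y ∈ V, tDerivFun v S t y =
      lapAt (G t) (v t) y - 2⁻¹ * v t y * gradSqAt (G t) (v t) y) :
    tDerivFun (fun s y ↦ gradSqAt (G s) (v s) y) S t x =
      lapAt (G t) (gradSqAt (G t) (v t)) x
        - 2 * normSqAt (G t) x (hessAt (G t) (v t) x)
        - gradSqAt (G t) (v t) x ^ 2
        - v t x * fderiv ℝ (gradSqAt (G t) (v t)) x (sharpAt (G t) x (fderiv ℝ (v t) x)) := by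
  have hGt := hG.isMetricOn t ht
  have hVo : IsOpen V := hG.isOpen ht
  have hvt : ContDiffOn ℝ ∞ (v t) V := contDiffOn_of_family hv ht
  -- the time derivative of `|∇v|²` under the flow
  have hd := (hG.hasDerivWithinAt_gradSqAt_ricciFlow hfl hv hx ht).derivWithin (hG.uniqueDiffOn t ht)
  -- `w = |∇v_t|²`, `Δ v_t`
  set w : E → ℝ := gradSqAt (G t) (v t) with hw
  have hΔ : ContDiffOn ℝ ∞ (lapAt (G t) (v t)) V := hGt.contDiffOn_lapAt hvt
  have hwV : ContDiffOn ℝ ∞ w V := hGt.contDiffOn_gradSqAt hvt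
  have hΔd : DifferentiableAt ℝ (lapAt (G t) (v t)) x :=
    (contDiffAt_of_contDiffOn hVo hΔ hx).differentiableAt (by simp)
  have hwd : DifferentiableAt ℝ w x :=
    (contDiffAt_of_contDiffOn hVo hwV hx).differentiableAt (by simp)
  have hvd : DifferentiableAt ℝ (v t) x :=
    (contDiffAt_of_contDiffOn hVo hvt hx).differentiableAt (by simp)
  -- `D v̇ = D(Δ v) − ½ v Dw − ½ w Dv` at `x` (the equation holds on the neighbourhood `V` of `x`)
  have hweq : tDerivFun v S t =ᶠ[𝓝 x] fun y ↦ lapAt (G t) (v t) y - 2⁻¹ * v t y * w y := by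
    filter_upwards [hVo.mem_nhds hx] with y hy using hveq y hy
  have hprod : HasFDerivAt (fun y ↦ 2⁻¹ * v t y * w y)
      ((2⁻¹ * v t x) • fderiv ℝ w x + w x • ((2⁻¹ : ℝ) • fderiv ℝ (v t) x)) x :=
    (hvd.hasFDerivAt.const_mul 2⁻¹).mul hwd.hasFDerivAt
  have hrhs : HasFDerivAt (fun y ↦ lapAt (G t) (v t) y - 2⁻¹ * v t y * w y)
      (fderiv ℝ (lapAt (G t) (v t)) x
        - ((2⁻¹ * v t x) • fderiv ℝ w x + w x • ((2⁻¹ : ℝ) • fderiv ℝ (v t) x))) x :=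
    hΔd.hasFDerivAt.sub hprod
  have hD : fderiv ℝ (tDerivFun v S t) x = fderiv ℝ (lapAt (G t) (v t)) x
      - ((2⁻¹ * v t x) • fderiv ℝ w x + w x • ((2⁻¹ : ℝ) • fderiv ℝ (v t) x)) := by
    rw [hweq.fderiv_eq, hrhs.fderiv]
  -- the Bochner formula
  have hB := hGt.lapAt_gradSqAt hx hvt
  -- `Dv(♯Dv) = w x`
  have hww : fderiv ℝ (v t) x (sharpAt (G t) x (fderiv ℝ (v t) x)) = w x := rfl
  change derivWithin (fun s ↦ gradSqAt (G s) (v s) x) S t = _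
  rw [hd, hD, hB]
  simp only [_root_.sub_apply, _root_.add_apply, _root_.smul_apply, smul_eq_mul, hww]
  ring

/-- **Bamler's differential inequality for `|∇h|²`, in coordinates** (Bamler 2020a, proof of
Thm. 4.1, last display: "`½ ∂ₜ|∇h|² ≤ ½ Δ|∇h|² − (1/2t) ∇h · h ∇|∇h|² + (1/2t)(1 − |∇h|²)|∇h|²`",
here at scale one in the variable `v = Φ⁻¹ ∘ u`, where it reads
`∂ₜ w ≤ Δ w − v ⟨∇v, ∇w⟩ − w²`, `w = |∇v|²`): under the hypotheses of
`tDerivFun_gradSqAt_eq_of_halfFlow`, if `G t x` is positive definite then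

  `∂ₜ w ≤ Δ w − w² − v · Dw(♯Dv)`

(drop `−2|Hess v|² ≤ 0`, `normSqAt_nonneg_of_posDef`). [cite: Bamler2020Entropy, §4.2, proof of Thm. 4.1] -/
theorem tDerivFun_gradSqAt_le_of_halfFlow
    (hv : ContDiffOn ℝ ∞ (fun p : E × ℝ ↦ v p.2 p.1) (V ×ˢ S)) (hx : x ∈ V) (ht : t ∈ S)
    (hveq : ∀ y ∈ V, tDerivFun v S t y =
      lapAt (G t) (v t) y - 2⁻¹ * v t y * gradSqAt (G t) (v t) y)
    (hposdef : ∀ e : E, e ≠ 0 → 0 < G t x e e) :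
    tDerivFun (fun s y ↦ gradSqAt (G s) (v s) y) S t x ≤
      lapAt (G t) (gradSqAt (G t) (v t)) x
        - gradSqAt (G t) (v t) x ^ 2
        - v t x * fderiv ℝ (gradSqAt (G t) (v t)) x (sharpAt (G t) x (fderiv ℝ (v t) x)) := by
  rw [hG.tDerivFun_gradSqAt_eq_of_halfFlow hfl hv hx ht hveq]
  have hn := normSqAt_nonneg_of_posDef ((hG.isMetricOn t ht).symm x hx) hposdef
    (hessAt (G t) (v t) x)
  linarith

end IsMetricFamilyOn

/-! ## Part C — from the heat equation for `u ∈ (0,1)` to the equation of `v = Φ⁻¹ ∘ u` -/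

section PhiInverse

open Literature.Geometry.Riemannian Literature.Geometry.Riemannian.MetricFlow

variable {E : Type*} [NormedAddCommGroup E] [NormedSpace ℝ E] [FiniteDimensional ℝ E]
  {G : ℝ → E → E →L[ℝ] E →L[ℝ] ℝ} {S : Set ℝ} {V : Set E} {x : E} {t : ℝ} {u : ℝ → E → ℝ}

omit [FiniteDimensional ℝ E] in
/-- `Φ⁻¹ ∘ u` is `C^∞` on `V × S` for `u` `C^∞` on `V × S` with values in `(0, 1)`
(`Φ⁻¹` is `C^∞` on `(0, 1)`, `MetricFlow.contDiffOn_PhiInv`). [cite: Bamler2020Entropy, §4.1] -/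
theorem contDiffOn_PhiInv_family (hu : ContDiffOn ℝ ∞ (fun p : E × ℝ ↦ u p.2 p.1) (V ×ˢ S))
    (hu01 : ∀ s ∈ S, ∀ y ∈ V, u s y ∈ Ioo (0 : ℝ) 1) :
    ContDiffOn ℝ ∞ (fun p : E × ℝ ↦ PhiInv (u p.2 p.1)) (V ×ˢ S) :=
  contDiffOn_PhiInv.comp hu fun p hp ↦ hu01 p.2 hp.2 p.1 hp.1

/-- **The equation of `h = Φ⁻¹ ∘ u` in Bamler's proof of the gradient estimate, in
coordinates** (Bamler 2020a, §4.2, first two displays: "`∂ₜh Φ'_t + ∂ₜΦ_t = ∂ₜu_t = Δu =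
Δh Φ'_t + |∇h|² Φ''_t`", "`Φ''_t(x) = −(x/2t) Φ'_t`", here at the fixed scale `t = 1`, i.e. for
`Φ` itself). Let `u` be `C^∞` on `V × S` (`V` open, `S` with unique derivatives) with values in
`(0, 1)` and solve the heat equation in coordinates `∂ₜu = Δ_{G t} u` at `(x, t)`. Then
`v = Φ⁻¹ ∘ u` solves at `(x, t)`

  `∂ₜ v = Δ_{G t} v − ½ v |∇v|²_{G t}`

(chain rules `∂ₜ(Φ ∘ v) = Φ'(v) ∂ₜv`, `Δ(Φ ∘ v) = Φ'(v)Δv + Φ''(v)|∇v|²`,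
`lapAt_comp_of_contDiffAt`, with `Φ'' = −(x/2)Φ'`, `MetricFlow.deriv_deriv_Phi`, and `Φ' > 0`).
[cite: Bamler2020Entropy, §4.2, proof of Thm. 4.1] -/
theorem tDerivFun_PhiInv_eq_of_heat (hV : IsOpen V) (hS : UniqueDiffOn ℝ S)
    (hu : ContDiffOn ℝ ∞ (fun p : E × ℝ ↦ u p.2 p.1) (V ×ˢ S))
    (hu01 : ∀ s ∈ S, ∀ y ∈ V, u s y ∈ Ioo (0 : ℝ) 1) (hx : x ∈ V) (ht : t ∈ S)
    (hueq : tDerivFun u S t x = lapAt (G t) (u t) x) :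
    tDerivFun (fun s y ↦ PhiInv (u s y)) S t x =
      lapAt (G t) (fun y ↦ PhiInv (u t y)) x
        - 2⁻¹ * PhiInv (u t x) * gradSqAt (G t) (fun y ↦ PhiInv (u t y)) x := by
  set v : ℝ → E → ℝ := fun s y ↦ PhiInv (u s y) with hvdef
  have hv : ContDiffOn ℝ ∞ (fun p : E × ℝ ↦ v p.2 p.1) (V ×ˢ S) := contDiffOn_PhiInv_family hu hu01
  -- `u = Φ ∘ v` on `V × S`
  have huv : ∀ s ∈ S, ∀ y ∈ V, u s y = Phi (v s y) := fun s hs y hy ↦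
    (Phi_PhiInv (hu01 s hs y hy).1 (hu01 s hs y hy).2).symm
  have hvt : ContDiffOn ℝ ∞ (v t) V := contDiffOn_of_family hv ht
  have hv2 : ContDiffAt ℝ 2 (v t) x := contDiffAt_two_of_contDiffOn hV hvt hx
  have hΦ2 : ContDiffAt ℝ 2 Phi (v t x) := contDiff_Phi.contDiffAt.of_le (by norm_cast)
  -- the time derivative: `∂ₜu = Φ'(v) ∂ₜv`
  have hdv : HasDerivWithinAt (fun s ↦ v s x) (tDerivFun v S t x) S t :=
    hasDerivWithinAt_of_family hv hx ht
  have hdu : HasDerivWithinAt (fun s ↦ u s x) (deriv Phi (v t x) * tDerivFun v S t x) S t := by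
    have h := (hasDerivAt_Phi (v t x)).comp_hasDerivWithinAt t hdv
    rw [← deriv_Phi] at h
    refine h.congr_of_mem (fun s hs ↦ ?_) ht
    exact huv s hs x hx
  have hdu' : tDerivFun u S t x = deriv Phi (v t x) * tDerivFun v S t x :=
    hdu.derivWithin (hS t ht)
  -- the Laplacian: `Δu = Φ'(v)Δv + Φ''(v)|∇v|²`
  have hueq' : u t =ᶠ[𝓝 x] fun y ↦ Phi (v t y) := by
    filter_upwards [hV.mem_nhds hx] with y hy using huv t ht y hy
  have hΔu : lapAt (G t) (u t) x =
      deriv Phi (v t x) * lapAt (G t) (v t) x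
        + deriv (deriv Phi) (v t x) * gradSqAt (G t) (v t) x := by
    rw [lapAt_congr_of_eventuallyEq (G t) hueq', lapAt_comp_of_contDiffAt hΦ2 hv2]
  -- combine and divide by `Φ'(v) > 0`
  have hpos : 0 < deriv Phi (v t x) := deriv_Phi_pos _
  rw [hdu', hΔu, deriv_deriv_Phi] at hueq
  have hkey : deriv Phi (v t x) * (tDerivFun v S t x
      - (lapAt (G t) (v t) x - 2⁻¹ * v t x * gradSqAt (G t) (v t) x)) = 0 := by
    linear_combination hueq
  have h0 := (mul_eq_zero.1 hkey).resolve_left hpos.ne'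
  linarith

end PhiInverse

end MetricCoord

end Literature.Geometry.Lorentzian


/-! ## Part B — the differential inequality for `|∇(Φ⁻¹ ∘ u)|²` on the manifold -/

namespace Literature.Geometry.Riemannian

open Lorentzian Lorentzian.PseudoRiemannianMetric MetricFlow

section ChartBridge

variable {E : Type*} [NormedAddCommGroup E] [NormedSpace ℝ E] [FiniteDimensional ℝ E]
  [CompleteSpace E] {H : Type*} [TopologicalSpace H] {I : ModelWithCorners ℝ E H} [I.Boundaryless]
  {M : Type*} [TopologicalSpace M] [ChartedSpace H M] [IsManifold I ∞ M]

omit [CompleteSpace E] in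
/-- **`g⁻¹(df₁, df₂)` of a metric on an open subset of `E` in terms of representatives**:
`g⁻¹(df₁, df₂)(x) = DΦ₁(x)(♯_{G x} DΦ₂(x))` whenever `fᵢ = Φᵢ` on `U` with `Φᵢ` differentiable at
`x` (`OpensChart.mvfderiv_eq`, `OpensChart.sharp_eq_sharpAt`). [cite: ONeill1983, Ch. 3, p. 60] -/
theorem _root_.Literature.Geometry.Lorentzian.OpensChart.innerDual_eq_of_repr
    {U : TopologicalSpace.Opens E}
    {g : PseudoRiemannianMetric 𝓘(ℝ, E) ∞ E (TangentSpace 𝓘(ℝ, E) : U → Type _)}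
    {G : E → E →L[ℝ] E →L[ℝ] ℝ} (hG : ∀ y : U, g.val y = G y) (x : U) {f₁ f₂ : U → ℝ}
    {Φ₁ Φ₂ : E → ℝ} (hf₁ : ∀ y : U, f₁ y = Φ₁ y) (hf₂ : ∀ y : U, f₂ y = Φ₂ y)
    (hΦ₁ : DifferentiableAt ℝ Φ₁ x) (hΦ₂ : DifferentiableAt ℝ Φ₂ x) :
    g.innerDual x (mvfderiv 𝓘(ℝ, E) f₁ x : TangentSpace 𝓘(ℝ, E) x →ₗ[ℝ] ℝ)
        (mvfderiv 𝓘(ℝ, E) f₂ x : TangentSpace 𝓘(ℝ, E) x →ₗ[ℝ] ℝ) =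
      fderiv ℝ Φ₁ x (MetricCoord.sharpAt G x (fderiv ℝ Φ₂ x)) := by
  have hd₁ : (mvfderiv 𝓘(ℝ, E) f₁ x : TangentSpace 𝓘(ℝ, E) x →L[ℝ] ℝ) = fderiv ℝ Φ₁ x := by
    ext v
    exact OpensChart.mvfderiv_eq x f₁ Φ₁ hf₁ hΦ₁ v
  have hd₂ : (mvfderiv 𝓘(ℝ, E) f₂ x : TangentSpace 𝓘(ℝ, E) x →L[ℝ] ℝ) = fderiv ℝ Φ₂ x := by
    ext v
    exact OpensChart.mvfderiv_eq x f₂ Φ₂ hf₂ hΦ₂ v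
  rw [PseudoRiemannianMetric.innerDual, hd₁, hd₂, OpensChart.sharp_eq_sharpAt hG x]
  rfl

omit [CompleteSpace E] in
/-- **`g⁻¹(dF₁, dF₂)` read in the chart of a family**: for representatives `Fcᵢ` of `Fᵢ` on the
chart target at `x₀` (`Fᵢ (Φ y) = Fcᵢ y`), differentiable at `u`, with `Fᵢ` differentiable at
`Φ u`: `(g s)⁻¹(dF₁, dF₂)(Φ u) = DFc₁(u)(♯_{G s u} DFc₂(u))`, `G = chartRep I g x₀`
(`innerDual_mvfderiv_comp`, `OpensChart.innerDual_eq_of_repr`).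
[cite: ONeill1983, Ch. 3, Prop. 3.59] -/
theorem innerDual_chartRep_eq (g : ℝ → PseudoRiemannianMetric I ∞ E (TangentSpace I : M → Type _))
    (x₀ : M) (s : ℝ) (u : chartTarget I x₀) {F₁ F₂ : M → ℝ} {Fc₁ Fc₂ : E → ℝ}
    (hrep₁ : ∀ y : chartTarget I x₀, F₁ (chartInv I x₀ y) = Fc₁ y)
    (hrep₂ : ∀ y : chartTarget I x₀, F₂ (chartInv I x₀ y) = Fc₂ y)
    (hF₁ : MDifferentiableAt I 𝓘(ℝ, ℝ) F₁ (chartInv I x₀ u))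
    (hF₂ : MDifferentiableAt I 𝓘(ℝ, ℝ) F₂ (chartInv I x₀ u))
    (hFc₁ : DifferentiableAt ℝ Fc₁ u) (hFc₂ : DifferentiableAt ℝ Fc₂ u) :
    (g s).innerDual (chartInv I x₀ u)
        (mvfderiv I F₁ (chartInv I x₀ u) : TangentSpace I (chartInv I x₀ u) →ₗ[ℝ] ℝ)
        (mvfderiv I F₂ (chartInv I x₀ u) : TangentSpace I (chartInv I x₀ u) →ₗ[ℝ] ℝ) =
      fderiv ℝ Fc₁ u (MetricCoord.sharpAt (chartRep I g x₀ s) u (fderiv ℝ Fc₂ u)) := by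
  have hG := val_chartPullback_eq_chartRep g x₀ s
  rw [← (g s).innerDual_mvfderiv_comp contMDiff_pullbackBilin_holds (contMDiff_chartInv x₀)
    (injective_mfderiv_chartInv x₀) rfl u hF₁ hF₂]
  exact OpensChart.innerDual_eq_of_repr hG u (f₁ := F₁ ∘ chartInv I x₀)
    (f₂ := F₂ ∘ chartInv I x₀) hrep₁ hrep₂ hFc₁ hFc₂

end ChartBridge

section Pointwise

variable {E : Type*} [NormedAddCommGroup E] [NormedSpace ℝ E] [FiniteDimensional ℝ E]
  [CompleteSpace E] {H : Type*} [TopologicalSpace H] {I : ModelWithCorners ℝ E H} [I.Boundaryless]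
  {M : Type*} [TopologicalSpace M] [ChartedSpace H M] [IsManifold I ∞ M]
  {g : ℝ → PseudoRiemannianMetric I ∞ E (TangentSpace I : M → Type _)}
  {cov : ℝ → CovariantDerivative I E (TangentSpace I : M → Type _)}

omit [FiniteDimensional ℝ E] [CompleteSpace E] [I.Boundaryless] [IsManifold I ∞ M] in
/-- `Φ⁻¹ ∘ u` is `C^∞` on `M × S` for `u` `C^∞` on `M × S` with values in `(0, 1)`.
[cite: Bamler2020Entropy, §4.1] -/
theorem contMDiffOn_PhiInv_family {u : ℝ → M → ℝ} {S : Set ℝ}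
    (hu : ContMDiffOn (I.prod 𝓘(ℝ, ℝ)) 𝓘(ℝ, ℝ) ∞ (fun p : M × ℝ ↦ u p.2 p.1) (univ ×ˢ S))
    (hu01 : ∀ t ∈ S, ∀ x, u t x ∈ Ioo (0 : ℝ) 1) :
    ContMDiffOn (I.prod 𝓘(ℝ, ℝ)) 𝓘(ℝ, ℝ) ∞ (fun p : M × ℝ ↦ PhiInv (u p.2 p.1)) (univ ×ˢ S) := by
  have hP : ContMDiffOn 𝓘(ℝ, ℝ) 𝓘(ℝ, ℝ) ∞ PhiInv (Ioo (0 : ℝ) 1) :=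
    contMDiffOn_iff_contDiffOn.2 contDiffOn_PhiInv
  exact hP.comp hu fun p hp ↦ hu01 p.2 hp.2 p.1

/-- **Bamler's differential inequality for `|∇(Φ⁻¹ ∘ u)|²` on a manifold** (Bamler 2020a,
§4.2, proof of Thm. 4.1, last display, at scale one). Let `(g, cov)` be a Ricci flow of
Riemannian metrics on `[0, T']`, `T' > 0`, on a manifold with boundaryless model (no compactness
needed here), and `u` a solution of the heat equation `∂ₜu = Δ_{g(t)} u`, `C^∞` on `M × [0, T']`,
with values in `(0, 1)`. Put `v = Φ⁻¹ ∘ u` and `w = |∇v|²_{g(t)}`. Then at every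
`(x, t) ∈ M × [0, T']`:

  `∂ₜ w ≤ Δ_{g(t)} w − v · g(t)⁻¹(dw, dv) − w²`

(read the flow, `u`, `v`, `w` in the chart at `x` — `IsRicciFlow.isMetricFamilyOn_chartRep`,
`tDeriv_chartRep_eq`, `lapAt_chartRep_eq`, `gradSqAt_chartRep_eq`, `innerDual_chartRep_eq` — and
apply the coordinate statements `MetricCoord.tDerivFun_PhiInv_eq_of_heat` and
`MetricCoord.IsMetricFamilyOn.tDerivFun_gradSqAt_le_of_halfFlow`).
[cite: Bamler2020Entropy, §4.2, proof of Thm. 4.1] -/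
theorem IsRicciFlow.derivWithin_gradSq_PhiInv_le {T' : ℝ} (hT' : 0 < T')
    (h : IsRicciFlow g cov (Icc 0 T')) (hR : ∀ t ∈ Icc 0 T', (g t).IsRiemannian)
    {u : ℝ → M → ℝ}
    (hu : ContMDiffOn (I.prod 𝓘(ℝ, ℝ)) 𝓘(ℝ, ℝ) ∞ (fun p : M × ℝ ↦ u p.2 p.1) (univ ×ˢ Icc 0 T'))
    (hu01 : ∀ t ∈ Icc 0 T', ∀ x, u t x ∈ Ioo (0 : ℝ) 1)
    (hueq : ∀ t ∈ Icc 0 T', ∀ x : M,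
      HasDerivWithinAt (fun s ↦ u s x) ((g t).laplaceBeltrami (u t) x) (Icc 0 T') t)
    {t : ℝ} (ht : t ∈ Icc 0 T') (x : M) :
    derivWithin (fun s ↦ (g s).gradSq (fun y ↦ PhiInv (u s y)) x) (Icc 0 T') t ≤
      (g t).laplaceBeltrami ((g t).gradSq (fun y ↦ PhiInv (u t y))) x
        - PhiInv (u t x) * (g t).innerDual x
            (mvfderiv I ((g t).gradSq (fun y ↦ PhiInv (u t y))) x : TangentSpace I x →ₗ[ℝ] ℝ)
            (mvfderiv I (fun y ↦ PhiInv (u t y)) x : TangentSpace I x →ₗ[ℝ] ℝ)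
        - ((g t).gradSq (fun y ↦ PhiInv (u t y)) x) ^ 2 := by
  have h2 : (2 : ℕ∞ω) ≤ ∞ := WithTop.coe_le_coe.mpr le_top
  have hS : UniqueDiffOn ℝ (Icc 0 T') := uniqueDiffOn_Icc hT'
  have hVopen : IsOpen (extChartAt I x).target := isOpen_extChartAt_target x
  -- (1) the flow read in the chart at `x`
  have hfam := h.isMetricFamilyOn_chartRep hT' x
  have hfl : ∀ s ∈ Icc 0 T', ∀ y ∈ (extChartAt I x).target,
      MetricCoord.tDeriv (chartRep I g x) (Icc 0 T') s y =
        (-2 : ℝ) • MetricCoord.ricAt (chartRep I g x s) y := fun s hs y hy ↦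
    h.tDeriv_chartRep_eq hT' x hs hy
  -- (2) `u` and `v = Φ⁻¹ ∘ u` read in the chart
  set uc : ℝ → E → ℝ := fun s y ↦ u s ((extChartAt I x).symm y) with huc
  have huc_smooth : ContDiffOn ℝ ∞ (fun q : E × ℝ ↦ uc q.2 q.1)
      ((extChartAt I x).target ×ˢ Icc 0 T') :=
    contDiffOn_chart_of_contMDiffOn_source_prod (k := (⊤ : ℕ∞)) (w := u) x
      (hu.mono (prod_mono (subset_univ _) Subset.rfl))
  have huc01 : ∀ s ∈ Icc 0 T', ∀ y ∈ (extChartAt I x).target, uc s y ∈ Ioo (0 : ℝ) 1 :=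
    fun s hs y _ ↦ hu01 s hs _
  have hv : ContMDiffOn (I.prod 𝓘(ℝ, ℝ)) 𝓘(ℝ, ℝ) ∞
      (fun p : M × ℝ ↦ PhiInv (u p.2 p.1)) (univ ×ˢ Icc 0 T') := contMDiffOn_PhiInv_family hu hu01
  have hvc_smooth : ContDiffOn ℝ ∞ (fun q : E × ℝ ↦ PhiInv (uc q.2 q.1))
      ((extChartAt I x).target ×ˢ Icc 0 T') :=
    MetricCoord.contDiffOn_PhiInv_family huc_smooth huc01
  have huslice : ∀ s ∈ Icc 0 T', ContMDiff I 𝓘(ℝ, ℝ) ∞ (u s) := fun s hs ↦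
    contMDiff_slice_of_contMDiffOn hu hs
  have hvslice : ∀ s ∈ Icc 0 T', ContMDiff I 𝓘(ℝ, ℝ) ∞ (fun y ↦ PhiInv (u s y)) := fun s hs ↦
    contMDiff_slice_of_contMDiffOn (u := fun s y ↦ PhiInv (u s y)) hv hs
  have huc2 : ∀ s ∈ Icc 0 T', ∀ y : chartTarget I x, ContDiffAt ℝ 2 (uc s) y := fun s hs y ↦
    ((MetricCoord.contDiffOn_of_family huc_smooth hs).contDiffAt (hVopen.mem_nhds y.2)).of_le h2
  have hvct : ∀ s ∈ Icc 0 T', ContDiffOn ℝ ∞ (fun y ↦ PhiInv (uc s y)) (extChartAt I x).target :=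
    fun s hs ↦ MetricCoord.contDiffOn_of_family (f := fun s z ↦ PhiInv (uc s z)) hvc_smooth hs
  have hvc2 : ∀ s ∈ Icc 0 T', ∀ y : chartTarget I x,
      ContDiffAt ℝ 2 (fun z ↦ PhiInv (uc s z)) y := fun s hs y ↦
    ((hvct s hs).contDiffAt (hVopen.mem_nhds y.2)).of_le h2
  have hurep : ∀ s, ∀ y : chartTarget I x, u s (chartInv I x y) = uc s y := fun s y ↦ rfl
  have hvrep : ∀ s, ∀ y : chartTarget I x,
      (fun z ↦ PhiInv (u s z)) (chartInv I x y) = PhiInv (uc s y) := fun s y ↦ rfl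
  -- (3) the heat equation read in the chart, on `target × [0, T']`
  have hueqc : ∀ s ∈ Icc 0 T', ∀ y ∈ (extChartAt I x).target,
      MetricCoord.tDerivFun uc (Icc 0 T') s y = MetricCoord.lapAt (chartRep I g x s) (uc s) y := by
    intro s hs y hy
    have hΔ := lapAt_chartRep_eq g x s ⟨y, hy⟩ (hurep s) (((huslice s hs) _).of_le h2)
      (huc2 s hs ⟨y, hy⟩)
    rw [MetricCoord.tDerivFun, hΔ]
    exact (hueq s hs _).derivWithin (hS s hs)
  -- (4) the equation of `v` in the chart at time `t`, and the coordinate inequality at `(φ x, t)`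
  have hveqc : ∀ y ∈ (extChartAt I x).target,
      MetricCoord.tDerivFun (fun s z ↦ PhiInv (uc s z)) (Icc 0 T') t y =
        MetricCoord.lapAt (chartRep I g x t) (fun z ↦ PhiInv (uc t z)) y
          - 2⁻¹ * PhiInv (uc t y) *
            MetricCoord.gradSqAt (chartRep I g x t) (fun z ↦ PhiInv (uc t z)) y :=
    fun y hy ↦ MetricCoord.tDerivFun_PhiInv_eq_of_heat hVopen hS huc_smooth huc01 hy ht
      (hueqc t ht y hy)
  have hy₀ : extChartAt I x x ∈ (extChartAt I x).target := mem_extChartAt_target x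
  have hposdef : ∀ e : E, e ≠ 0 → 0 < chartRep I g x t (extChartAt I x x) e e := fun e he ↦
    chartRep_posDef g x t (hR t ht) ⟨_, hy₀⟩ e he
  have key := hfam.tDerivFun_gradSqAt_le_of_halfFlow hfl (v := fun s z ↦ PhiInv (uc s z))
    hvc_smooth hy₀ ht hveqc hposdef
  -- (5) transport of each term back to `x`
  set u₀ : chartTarget I x := ⟨extChartAt I x x, hy₀⟩ with hu₀def
  have hΦ0 : chartInv I x u₀ = x := extChartAt_to_inv x
  have hGt := hfam.isMetricOn t ht
  -- (a) `|∇v_s|²(x) = gradSqAt (G s) (vc s) (φ x)` for `s ∈ [0, T']`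
  have hgrad : ∀ s ∈ Icc 0 T', (g s).gradSq (fun y ↦ PhiInv (u s y)) x =
      MetricCoord.gradSqAt (chartRep I g x s) (fun z ↦ PhiInv (uc s z)) (extChartAt I x x) := by
    intro s hs
    have h' := gradSqAt_chartRep_eq g x s u₀ (hvrep s)
      (((hvslice s hs) _).mdifferentiableAt (by simp))
      ((hvc2 s hs u₀).differentiableAt two_ne_zero)
    rw [hΦ0] at h'
    exact h'.symm
  -- (b) the representative of `w_t = |∇v_t|²` on the chart target
  have hW : ContMDiffOn (I.prod 𝓘(ℝ, ℝ)) 𝓘(ℝ, ℝ) ∞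
      (fun p : M × ℝ ↦ (g p.2).gradSq (fun y ↦ PhiInv (u p.2 y)) p.1) (univ ×ˢ Icc 0 T') :=
    h.smooth.contMDiffOn_gradSq hS (f := fun s y ↦ PhiInv (u s y)) hv
  have hWslice : ContMDiff I 𝓘(ℝ, ℝ) ∞ ((g t).gradSq (fun y ↦ PhiInv (u t y))) :=
    contMDiff_slice_of_contMDiffOn (u := fun s y ↦ (g s).gradSq (fun z ↦ PhiInv (u s z)) y) hW ht
  have hWrep : ∀ y : chartTarget I x, (g t).gradSq (fun z ↦ PhiInv (u t z)) (chartInv I x y) =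
      MetricCoord.gradSqAt (chartRep I g x t) (fun z ↦ PhiInv (uc t z)) y := fun y ↦
    (gradSqAt_chartRep_eq g x t y (hvrep t) (((hvslice t ht) _).mdifferentiableAt (by simp))
      ((hvc2 t ht y).differentiableAt two_ne_zero)).symm
  have hWc : ContDiffOn ℝ ∞ (MetricCoord.gradSqAt (chartRep I g x t) (fun z ↦ PhiInv (uc t z)))
      (extChartAt I x).target := hGt.contDiffOn_gradSqAt (hvct t ht)
  -- (c) the time derivative
  have e1 : derivWithin (fun s ↦ (g s).gradSq (fun y ↦ PhiInv (u s y)) x) (Icc 0 T') t =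
      MetricCoord.tDerivFun (fun s z ↦ MetricCoord.gradSqAt (chartRep I g x s)
        (fun z' ↦ PhiInv (uc s z')) z) (Icc 0 T') t (extChartAt I x x) := by
    rw [MetricCoord.tDerivFun]
    exact derivWithin_congr (fun s hs ↦ hgrad s hs) (hgrad t ht)
  -- (d) the Laplacian of `w_t`
  have e2 : (g t).laplaceBeltrami ((g t).gradSq (fun y ↦ PhiInv (u t y))) x =
      MetricCoord.lapAt (chartRep I g x t)
        (MetricCoord.gradSqAt (chartRep I g x t) (fun z ↦ PhiInv (uc t z))) (extChartAt I x x) := by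
    have h' := lapAt_chartRep_eq g x t u₀ hWrep
      (by rw [hΦ0]; exact (hWslice x).of_le h2)
      (MetricCoord.contDiffAt_two_of_contDiffOn hVopen hWc hy₀)
    rw [hΦ0] at h'
    exact h'.symm
  -- (e) the drift term `g⁻¹(dw, dv)`
  have e3 : (g t).innerDual x
      (mvfderiv I ((g t).gradSq (fun y ↦ PhiInv (u t y))) x : TangentSpace I x →ₗ[ℝ] ℝ)
      (mvfderiv I (fun y ↦ PhiInv (u t y)) x : TangentSpace I x →ₗ[ℝ] ℝ) =
      fderiv ℝ (MetricCoord.gradSqAt (chartRep I g x t) (fun z ↦ PhiInv (uc t z)))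
        (extChartAt I x x)
        (MetricCoord.sharpAt (chartRep I g x t) (extChartAt I x x)
          (fderiv ℝ (fun z ↦ PhiInv (uc t z)) (extChartAt I x x))) := by
    have h' := innerDual_chartRep_eq g x t u₀ hWrep (hvrep t)
      (by rw [hΦ0]; exact (hWslice x).mdifferentiableAt (by simp))
      (by rw [hΦ0]; exact ((hvslice t ht) x).mdifferentiableAt (by simp))
      ((MetricCoord.contDiffAt_two_of_contDiffOn hVopen hWc hy₀).differentiableAt two_ne_zero)
      ((hvc2 t ht u₀).differentiableAt two_ne_zero)
    rw [hΦ0] at h'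
    exact h'
  -- (f) the value `v_t(x)` and `w_t(x)`
  have e4 : PhiInv (u t x) = PhiInv (uc t (extChartAt I x x)) := by
    rw [← hurep t u₀, hΦ0]
  have e5 : (g t).gradSq (fun y ↦ PhiInv (u t y)) x =
      MetricCoord.gradSqAt (chartRep I g x t) (fun z ↦ PhiInv (uc t z)) (extChartAt I x x) :=
    hgrad t ht
  rw [e1, e2, e3, e4, e5]
  linarith [key]

end Pointwise


/-! ## Part D — the maximum principle: `|∇(Φ⁻¹ ∘ u_t)|² ≤ α / (1 + α t)`, and Theorem 4.1 -/

section GradientEstimate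

variable {E : Type*} [NormedAddCommGroup E] [NormedSpace ℝ E] [FiniteDimensional ℝ E]
  [CompleteSpace E] {H : Type*} [TopologicalSpace H] {I : ModelWithCorners ℝ E H} [I.Boundaryless]
  {M : Type*} [TopologicalSpace M] [ChartedSpace H M] [IsManifold I ∞ M] [CompactSpace M]
  {g : ℝ → PseudoRiemannianMetric I ∞ E (TangentSpace I : M → Type _)}
  {cov : ℝ → CovariantDerivative I E (TangentSpace I : M → Type _)}

/-- **The comparison bound in Bamler's proof of Thm. 4.1** ("By the maximum principle, the bound
`|∇h|² ≤ 1` remains preserved"), in un-normalised form. Let `(g, cov)` be a Ricci flow of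
Riemannian metrics on `[0, T']`, `T' > 0`, on a closed manifold, `u` a solution of
`∂ₜu = Δ_{g(t)}u`, `C^∞` on `M × [0, T']` with values in `(0, 1)`, and `α ≥ 0` a bound for
`|∇(Φ⁻¹ ∘ u₀)|²` at time `0`. Then for all `t ∈ [0, T']`,

  `|∇(Φ⁻¹ ∘ u_t)|²_{g(t)} ≤ α / (1 + α t)`.

Proof: the weak maximum principle (`weakMaximumPrinciple`, Topping 2006 Thm. 3.1.1) for
`w = |∇(Φ⁻¹ ∘ u)|²` with the differential inequality `∂ₜw ≤ Δw + ⟨X, ∇w⟩ − w²`,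
`X = −v ∇v` (`IsRicciFlow.derivWithin_gradSq_PhiInv_le`), against the solution
`φ(t) = α/(1 + αt)` of `φ' = −φ²`, `φ(0) = α`. [cite: Bamler2020Entropy, §4.2, proof of Thm. 4.1]
[cite: Topping2006, Thm. 3.1.1] -/
theorem IsRicciFlow.gradSq_PhiInv_le_div {T' : ℝ} (hT' : 0 < T')
    (h : IsRicciFlow g cov (Icc 0 T')) (hR : ∀ t ∈ Icc 0 T', (g t).IsRiemannian)
    {u : ℝ → M → ℝ}
    (hu : ContMDiffOn (I.prod 𝓘(ℝ, ℝ)) 𝓘(ℝ, ℝ) ∞ (fun p : M × ℝ ↦ u p.2 p.1) (univ ×ˢ Icc 0 T'))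
    (hu01 : ∀ t ∈ Icc 0 T', ∀ x, u t x ∈ Ioo (0 : ℝ) 1)
    (hueq : ∀ t ∈ Icc 0 T', ∀ x : M,
      HasDerivWithinAt (fun s ↦ u s x) ((g t).laplaceBeltrami (u t) x) (Icc 0 T') t)
    {α : ℝ} (hα : 0 ≤ α) (h0 : ∀ x, (g 0).gradSq (fun y ↦ PhiInv (u 0 y)) x ≤ α) :
    ∀ t ∈ Icc 0 T', ∀ x, (g t).gradSq (fun y ↦ PhiInv (u t y)) x ≤ α / (1 + α * t) := by
  have hS : UniqueDiffOn ℝ (Icc 0 T') := uniqueDiffOn_Icc hT'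
  have hv := contMDiffOn_PhiInv_family hu hu01
  -- `w = |∇(Φ⁻¹ ∘ u)|²` is `C^∞` on `M × [0, T']`
  have hWs : ContMDiffOn (I.prod 𝓘(ℝ, ℝ)) 𝓘(ℝ, ℝ) ∞
      (fun p : M × ℝ ↦ (g p.2).gradSq (fun y ↦ PhiInv (u p.2 y)) p.1) (univ ×ˢ Icc 0 T') :=
    h.smooth.contMDiffOn_gradSq hS (f := fun s y ↦ PhiInv (u s y)) hv
  -- the drift field `X = −v ∇v` and the reaction term `F(r) = −r²`
  set X : ℝ → (y : M) → TangentSpace I y := fun s y ↦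
    -(PhiInv (u s y)) • (g s).sharp y
      (mvfderiv I (fun z ↦ PhiInv (u s z)) y : TangentSpace I y →ₗ[ℝ] ℝ) with hX
  have hF : ContDiffOn ℝ 1 (uncurry fun (r _ : ℝ) ↦ -r ^ 2) (univ ×ˢ Icc 0 T') :=
    ((contDiff_fst (E := ℝ) (F := ℝ)).pow 2).neg.contDiffOn
  have hineq : ∀ t ∈ Icc 0 T', ∀ x : M,
      derivWithin (fun s ↦ (g s).gradSq (fun y ↦ PhiInv (u s y)) x) (Icc 0 T') t ≤
        (g t).laplaceBeltrami ((g t).gradSq (fun y ↦ PhiInv (u t y))) x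
          + mvfderiv I ((g t).gradSq (fun y ↦ PhiInv (u t y))) x (X t x)
          + (fun (r _ : ℝ) ↦ -r ^ 2) ((g t).gradSq (fun y ↦ PhiInv (u t y)) x) t := by
    intro t ht x
    have hpt := h.derivWithin_gradSq_PhiInv_le hT' hR hu hu01 hueq ht x
    have hXe : mvfderiv I ((g t).gradSq (fun y ↦ PhiInv (u t y))) x (X t x) =
        -(PhiInv (u t x)) * (g t).innerDual x
          (mvfderiv I ((g t).gradSq (fun y ↦ PhiInv (u t y))) x : TangentSpace I x →ₗ[ℝ] ℝ)
          (mvfderiv I (fun y ↦ PhiInv (u t y)) x : TangentSpace I x →ₗ[ℝ] ℝ) := by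
      rw [hX]
      simp only [map_smul, smul_eq_mul]
      rfl
    rw [hXe]
    linarith [hpt]
  -- the comparison function `φ(t) = α / (1 + α t)`, `φ' = −φ²`, `φ(0) = α`
  have hφ : ∀ t ∈ Icc 0 T', HasDerivWithinAt (fun s ↦ α / (1 + α * s))
      ((fun (r _ : ℝ) ↦ -r ^ 2) (α / (1 + α * t)) t) (Icc 0 T') t := by
    intro t ht
    have hpos : 0 < 1 + α * t := by
      have := mul_nonneg hα ht.1
      linarith
    have h1 : HasDerivAt (fun s ↦ 1 + α * s) α t := by
      simpa using ((hasDerivAt_id t).const_mul α).const_add 1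
    have h2 := (h1.inv hpos.ne').const_mul α
    have h3 : HasDerivAt (fun s ↦ α / (1 + α * s)) (-(α / (1 + α * t)) ^ 2) t := by
      have heq : (fun s ↦ α / (1 + α * s)) = fun s ↦ α * (1 + α * s)⁻¹ := by
        funext s
        rw [div_eq_mul_inv]
      rw [heq]
      refine h2.congr_deriv ?_
      rw [div_pow]
      ring
    exact h3.hasDerivWithinAt
  have hφ0 : (fun s ↦ α / (1 + α * s)) 0 = α := by simp
  exact weakMaximumPrinciple hT' hR X hF hWs hineq hφ hφ0 h0

/-- **Bamler 2020a, Theorem 4.1 (the improved gradient estimate).** "Consider a solution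
`u ∈ C^∞(M × [t₀, t₁])`, `[t₀, t₁] ⊂ I`, to the heat equation `∂ₜu = Δ_{g_t} u` coupled with the
super Ricci flow `(M, (g_t)_{t ∈ I})` [on a compact manifold] and let `T ≥ 0`. Suppose that `u`
only takes values in `(0, 1)` and suppose that `|∇(Φ_T⁻¹(u(·, t₀)))| ≤ 1` if `T > 0`. Then
`|∇(Φ⁻¹_{T+t−t₀}(u(·, t)))| ≤ 1` for all `t ∈ [t₀, t₁]`." Here `Φ_τ(x) = Φ(τ^{-1/2} x)`, so
`Φ_τ⁻¹ = τ^{1/2} Φ⁻¹` and the two conditions read `T |∇(Φ⁻¹ ∘ u_{t₀})|² ≤ 1` (vacuous for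
`T = 0`) and `(T + t − t₀) |∇(Φ⁻¹ ∘ u_t)|²_{g_t} ≤ 1` (vacuous at `t = t₀` if `T = 0`), which is the
form proved, for a Ricci flow `(g, cov)` of Riemannian metrics on the closed manifold `M` on the
time interval `[t₀, t₁] = [0, T']`, `T' > 0` (translate and restrict the flow with
`IsRicciFlow.comp_add_const` / `IsRicciFlow.mono`); `Φ⁻¹ = MetricFlow.PhiInv`,
`|∇·|² = PseudoRiemannianMetric.gradSq`, `Δ = laplaceBeltrami`; a smooth solution on
`M × [0, T']` in the sense of `IsHeatSolutionOn g u 0 T'` (`HeatEquationFamily.lean`) supplies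
`hu`, `hueq` as its two components. Proof (Bamler's): `v = Φ⁻¹ ∘ u` solves
`∂ₜv = Δv − ½v|∇v|²`, `w = |∇v|²` satisfies `∂ₜw ≤ Δw − v⟨∇v, ∇w⟩ − w²` (Bochner; the Ricci term
of the flow cancels), and the maximum principle gives `w ≤ α/(1 + αt)` for any bound `α` of `w`
at time `0` (`IsRicciFlow.gradSq_PhiInv_le_div`): `α = 1/T` if `T > 0`, and any bound (compactness)
if `T = 0`, since `αt/(1 + αt) < 1`. "Note that the theorem is sharp."
-- TODO(general form): Bamler states the theorem for SUPER Ricci flows `∂ₜg ≥ −2 Ric`; the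
-- tree's flow layer has the Ricci flow equation only (`IsRicciFlow`), for which it is proved here.
[cite: Bamler2020Entropy, §4.1, Thm. 4.1; §4.2 (proof)] -/
theorem IsRicciFlow.bamler_gradientEstimate {T' : ℝ} (hT' : 0 < T')
    (h : IsRicciFlow g cov (Icc 0 T')) (hR : ∀ t ∈ Icc 0 T', (g t).IsRiemannian)
    {u : ℝ → M → ℝ}
    (hu : ContMDiffOn (I.prod 𝓘(ℝ, ℝ)) 𝓘(ℝ, ℝ) ∞ (fun p : M × ℝ ↦ u p.2 p.1) (univ ×ˢ Icc 0 T'))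
    (hu01 : ∀ t ∈ Icc 0 T', ∀ x, u t x ∈ Ioo (0 : ℝ) 1)
    (hueq : ∀ t ∈ Icc 0 T', ∀ x : M,
      HasDerivWithinAt (fun s ↦ u s x) ((g t).laplaceBeltrami (u t) x) (Icc 0 T') t)
    {T : ℝ} (hT : 0 ≤ T) (hT0 : ∀ x, T * (g 0).gradSq (fun y ↦ PhiInv (u 0 y)) x ≤ 1) :
    ∀ t ∈ Icc 0 T', ∀ x, (T + t) * (g t).gradSq (fun y ↦ PhiInv (u t y)) x ≤ 1 := by
  intro t ht x
  rcases hT.eq_or_lt with hT0' | hTpos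
  · -- `T = 0`: any bound `α` at time `0` gives `t w ≤ αt/(1 + αt) ≤ 1`
    subst hT0'
    rw [zero_add]
    rcases ht.1.eq_or_lt with ht0 | htpos
    · subst ht0
      simp
    · have hS : UniqueDiffOn ℝ (Icc 0 T') := uniqueDiffOn_Icc hT'
      have hv := contMDiffOn_PhiInv_family hu hu01
      have hWs : ContMDiffOn (I.prod 𝓘(ℝ, ℝ)) 𝓘(ℝ, ℝ) ∞
          (fun p : M × ℝ ↦ (g p.2).gradSq (fun y ↦ PhiInv (u p.2 y)) p.1) (univ ×ˢ Icc 0 T') :=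
        h.smooth.contMDiffOn_gradSq hS (f := fun s y ↦ PhiInv (u s y)) hv
      have hW0 : Continuous ((g 0).gradSq (fun y ↦ PhiInv (u 0 y))) :=
        (contMDiff_slice_of_contMDiffOn (u := fun s y ↦ (g s).gradSq (fun z ↦ PhiInv (u s z)) y)
          hWs (left_mem_Icc.2 hT'.le)).continuous
      obtain ⟨A, hA⟩ : ∃ A : ℝ, ∀ y, (g 0).gradSq (fun z ↦ PhiInv (u 0 z)) y ≤ A := by
        rcases isEmpty_or_nonempty M with hM | hM
        · exact ⟨0, fun y ↦ (IsEmpty.false y).elim⟩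
        · obtain ⟨y₀, -, hy₀⟩ := isCompact_univ.exists_isMaxOn univ_nonempty hW0.continuousOn
          exact ⟨_, fun y ↦ hy₀ (mem_univ y)⟩
      have hα : 0 < max A 1 := lt_max_of_lt_right one_pos
      have hb := h.gradSq_PhiInv_le_div hT' hR hu hu01 hueq hα.le
        (fun y ↦ (hA y).trans (le_max_left _ _)) t ht x
      have hden : 0 < 1 + max A 1 * t := by positivity
      have h1 : t * (g t).gradSq (fun y ↦ PhiInv (u t y)) x ≤ t * (max A 1 / (1 + max A 1 * t)) :=
        mul_le_mul_of_nonneg_left hb htpos.le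
      have h2 : t * (max A 1 / (1 + max A 1 * t)) ≤ 1 := by
        rw [mul_div_assoc', div_le_one hden]
        linarith
      linarith
  · -- `T > 0`: `α = 1/T`, `φ(t) = 1/(T + t)`
    have h0 : ∀ y, (g 0).gradSq (fun z ↦ PhiInv (u 0 z)) y ≤ 1 / T := fun y ↦ by
      rw [le_div_iff₀ hTpos, mul_comm]
      exact hT0 y
    have hb := h.gradSq_PhiInv_le_div hT' hR hu hu01 hueq (by positivity) h0 t ht x
    have heq : 1 / T / (1 + 1 / T * t) = 1 / (T + t) := by
      field_simp
    rw [heq] at hb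
    have hTt : 0 < T + t := by linarith [ht.1]
    calc (T + t) * (g t).gradSq (fun y ↦ PhiInv (u t y)) x
        ≤ (T + t) * (1 / (T + t)) := mul_le_mul_of_nonneg_left hb hTt.le
      _ = 1 := by field_simp

end GradientEstimate

end Literature.Geometry.Riemannian

end
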